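import Literature.NumberTheory.EllipticCurves.Yin2026.SylvesterFourSevenProofs
import Literature.NumberTheory.EllipticCurves.DeuringHeckeContinuationFiveRows
import HarnessLib

/-!
# Sylvester `4, 7 (mod 9)` (Yin 2026): the Deuring–Hecke binder `hH` removed

Topic `Literature/NumberTheory/EllipticCurves/Yin2026`, namespace `Literature.NumberTheory.EllipticCurves.Yin2026`; sequel of
`SylvesterFourSevenProofs`.  THEOREMS ONLY.  The cube-sum curves `E_d : Y² = X³ − 432d²` have `j = 0`, and the `j = 0` row of the
Deuring–Hecke continuation (`hasEntireLFunction_of_j_mem_maximalCMJInvariants`, Silverman *Advanced Topics* II Cor. 10.5.1) is now a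
theorem of the tree (`DeuringHecke.hasEntireLFunction_of_j_eq_zero`, Hecke theta series of `ℤ[ω]`).  So the three statements of
`SylvesterFourSevenProofs` that carried the binder `hH` hold without it:

* `hasEntireLFunction_cubeSumCurve_holds` — `L(E_d, s)` is entire for every `d ≠ 0`, UNCONDITIONALLY;
* `bsdRank_cubeSumCurve_of_yin'`, `bsdRank_cubeSumCurve_prime_sq_of_yin'` — rank-BSD for `E_d`, `d ∈ {p, p²}`, `p ≡ 4, 7 (mod 9)`,
  modulo Yin's `hY`, `hYGZ` and Gross–Zagier–Kolyvagin `hGZK` only.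

Nothing about BSD beyond these conditional statements is proved here.

References: Silverman *ATAEC* II Cor. 10.5.1; Yin, arXiv:2605.25917v3 Thm. 8.7, arXiv:2607.01744v1 Thm. 1.1; Darmon 2004, Thm. 3.22.
-/

noncomputable section

open scoped Classical

open WeierstrassCurve

namespace Literature.NumberTheory.EllipticCurves.Yin2026

/-- **`L(E_d, s)` is entire for every `d ≠ 0`, UNCONDITIONALLY** (`E_d : Y² = X³ − 432d²`, `j = 0`): the Deuring–Hecke continuation for
`j = 0` is the tree theorem `DeuringHecke.hasEntireLFunction_of_j_eq_zero`. [cite: SilvermanATAEC1994, Ch. II Cor. 10.5.1] -/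
theorem hasEntireLFunction_cubeSumCurve_holds {d : ℚ} (hd : d ≠ 0) : (mordellCurve (-(432 * d ^ 2))).HasEntireLFunction := by
  haveI := isElliptic_cubeSumCurve hd
  exact DeuringHecke.hasEntireLFunction_of_j_eq_zero _ ((mordellCurve (-(432 * d ^ 2))).j_eq_zero (mordellCurve_c₄ _))

/-- **`ord_{s=1} L(E_d, s) = rank E_d(ℚ) = 1` and `#Ш(E_d/ℚ) < ∞` for `d ∈ {p, p²}`, `p ≡ 4, 7 (mod 9)` prime** — `bsdRank_cubeSumCurve_of_yin`
with the Deuring–Hecke binder `hH` DISCHARGED (modulo Yin's `hY`, `hYGZ` and `hGZK` only).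
[cite: Yin2026SylvesterGrossZagier, Thm. 1.1 of v1] [cite: Yin2026SylvesterFourSeven, Thm. 8.7 of v3] [cite: Darmon2004, Thm. 3.22] -/
theorem bsdRank_cubeSumCurve_of_yin'
    (hY : exists_not_isOfFinAddOrder_cubeSumCurve)
    (hYGZ : deriv_entireLFunction_one_ne_zero_cubeSumCurve)
    (hGZK : rank_eq_analyticRank_of_analyticRank_le_one)
    {p : ℕ} (hp : p.Prime) (h9 : p % 9 = 4 ∨ p % 9 = 7) {d : ℚ} (hdp : d = p ∨ d = (p : ℚ) ^ 2) :
    (mordellCurve (-(432 * d ^ 2))).analyticRank = 1 ∧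
      (mordellCurve (-(432 * d ^ 2))).mordellWeilRank = 1 ∧
      Finite (mordellCurve (-(432 * d ^ 2))).sha := by
  have hd : d ≠ 0 := by
    have hp0 : (p : ℚ) ≠ 0 := by exact_mod_cast hp.ne_zero
    rcases hdp with rfl | rfl
    · exact hp0
    · exact pow_ne_zero 2 hp0
  haveI := isElliptic_cubeSumCurve hd
  exact bsdRank_of_deriv_ne_zero_of_one_le_mordellWeilRank hGZK _
    (hasEntireLFunction_cubeSumCurve_holds hd) (hYGZ hp h9 hdp)
    (one_le_mordellWeilRank_cubeSumCurve_of_yin hY hp h9 hdp)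

/-- The `p²` clause: `ord_{s=1} L(E_{p²}, s) = rank E_{p²}(ℚ) = 1` and `#Ш(E_{p²}/ℚ) < ∞` for every prime `p ≡ 4, 7 (mod 9)`, modulo
`hY`, `hYGZ`, `hGZK` (no `hH`). [cite: Yin2026SylvesterGrossZagier, Thm. 1.1 of v1 (i = 2)] [cite: Yin2026SylvesterFourSeven, Thm. 8.7 of v3 (p²)] -/
theorem bsdRank_cubeSumCurve_prime_sq_of_yin'
    (hY : exists_not_isOfFinAddOrder_cubeSumCurve)
    (hYGZ : deriv_entireLFunction_one_ne_zero_cubeSumCurve)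
    (hGZK : rank_eq_analyticRank_of_analyticRank_le_one)
    {p : ℕ} (hp : p.Prime) (h9 : p % 9 = 4 ∨ p % 9 = 7) :
    (mordellCurve (-(432 * ((p : ℚ) ^ 2) ^ 2))).analyticRank = 1 ∧
      (mordellCurve (-(432 * ((p : ℚ) ^ 2) ^ 2))).mordellWeilRank = 1 ∧
      Finite (mordellCurve (-(432 * ((p : ℚ) ^ 2) ^ 2))).sha :=
  bsdRank_cubeSumCurve_of_yin' hY hYGZ hGZK hp h9 (Or.inr rfl)

end Literature.NumberTheory.EllipticCurves.Yin2026

end
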